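import Summits.ResolutionOfSingularities.ResolutionOfSingularities.Theorems.EquisingularLiftEquisingularLiftNatSubmaxLine
import Mathlib.Algebra.Polynomial.Div
import Mathlib.Algebra.MvPolynomial.Equiv
import Mathlib.Algebra.MvPolynomial.Funext
import Mathlib.Algebra.MvPolynomial.Nilpotent
import Mathlib.FieldTheory.IsAlgClosed.Basic
import HarnessLib

/-!
# [OURS · EL♮(3)] SURFACES IN `ℙ³` WITH A LINE OF SUBMAXIMAL MULTIPLICITY — the side conditions FOLLOW FROM PRIMALITY: EL♮, the B‴ nose
# predicate and a regular blow-up model for EVERY PRIME `F = x₀·A(x₂,x₃) + x₁·B(x₂,x₃) + C(x₂,x₃)` over `K = K̄`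
# (crux `Theses.EquisingularLift.EquisingularLiftNatThree`, stmt-ResolutionOfSingularities-20148; parent EL♮ stmt-…-20038; blow-up models: stmt-…-15660)

[OURS · leafhand-res-equisingularlift-7 g0, 2026-08-31; cell `pub/decomp-res`] AI-produced, weaker than expert review; NOT a statement of any
manuscript; nothing here proves resolution of singularities in positive characteristic.  DEF-FREE helper; no `sorry`; standard axioms; ZERO named
hypotheses.

`…NatSubmaxLine` proved `ELNatAt p K 3 H ι` for `H = V₊(x₀·A + x₁·B + C(x₂,x₃))` (`A, B` forms of degree `d + 1`, `C` of degree `d + 2`) under three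
side conditions: `F` prime, `(A, B) ≠ (0, 0)`, and `A, B, C` without common zero on `ℙ¹`.  Here the last two are DERIVED from the first over an
algebraically closed field:

* `X_sub_C_mul_X_dvd_of_eval_eq_zero` — **a binary form vanishing at `[c : 1]` is divisible by `s − c·t`** (division with remainder in `K[t][s]`
  through `finSuccEquiv`, the root certified pointwise by `MvPolynomial.funext` and homogeneity); `X_one_dvd_of_eval_eq_zero` (the point `[1 : 0]`,
  by the swap of variables); `exists_linear_dvd` — a common NON-ZERO LINEAR FACTOR for all forms vanishing at a given `v ≠ 0`;
* `not_prime_of_linear_dvd` — a form of degree `≥ 2` with a linear factor is not prime (units of `K[x]` are constants);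
* ★ `no_common_zero_of_prime` — `F` prime ⟹ `A, B, C` have no common zero on `ℙ¹` (a common zero `v` gives a common linear factor `ℓ(x₂,x₃)` of
  `A, B, C`, hence of `F`); `exists_eval_eq_zero` — every binary form of positive degree over `K = K̄` has a zero on `ℙ¹`
  (`IsAlgClosed.exists_root` on `C(t, 1)`, or `C = κ·t^m` vanishes at `[1 : 0]`); ★ `ne_zero_or_ne_zero_of_prime` — `F` prime ⟹ `(A, B) ≠ (0, 0)`;
* ★★ **`elNatAt_of_prime`**, ★ `reachNoseTowerBTriplePrime_of_prime`, ★ `blowupModel_of_prime` — the three certificates of `…NatSubmaxLine` for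
  EVERY PRIME `F = x₀·A + x₁·B + C(x₂,x₃)` (`A, B` forms of degree `d + 1`, `C` a form of degree `d + 2`), `K` algebraically closed, every `p`:
  **every integral surface of degree `d + 2` in `ℙ³_K` having multiplicity `≥ d + 1` along the line `V(x₂, x₃)` satisfies EL♮** — in particular EVERY
  integral cubic surface that is singular along that line (all four classical ruled/conical types and all cones over singular cubics at once).

References: Hartshorne I Ex. 5.12, II Ex. 2.9; The Stacks Project 07PF, 0804 — through the cited tree files.
-/

set_option linter.dupNamespace false -- mandated namespace `Summit.<Summit>.<Problem>` of this single-conjunct summit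

noncomputable section

open CategoryTheory CategoryTheory.Limits AlgebraicGeometry TopologicalSpace
open MvPolynomial
open Literature.AlgebraicGeometry.Resolution
open Literature.AlgebraicGeometry.Motives Literature.AlgebraicGeometry.Motives.SmoothHypersurface
open Literature.AlgebraicGeometry.Motives.ProjectiveSpace
open AlgebraicGeometry.Scheme.IdealSheafData

namespace Summit.ResolutionOfSingularities.ResolutionOfSingularities.Cruxes.EquisingularLiftNat.Sections

namespace SubmaxLine

variable (K : Type) [Field K]

/-! ## Linear factors of binary forms -/

/-- `G(u • q) = u ^ m · G(q)` for a form `G` of degree `m` (values in `K`). [folklore] -/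
theorem eval_smul_of_isHomogeneous {σ : Type*} {G : MvPolynomial σ K} {m : ℕ} (hG : G.IsHomogeneous m) (u : K) (q : σ → K) :
    MvPolynomial.eval (u • q) G = u ^ m * MvPolynomial.eval q G := by
  rw [← MvPolynomial.aeval_eq_eval, ← MvPolynomial.aeval_eq_eval]
  exact aeval_smul_of_isHomogeneous K hG u q

/-- **A binary form vanishing at `[c : 1]` is divisible by `s − c·t`** (`K` infinite; division with remainder by the monic `s − c·t` in `K[t][s]`,
the vanishing of the remainder checked at every point by homogeneity). [folklore] -/
theorem X_sub_C_mul_X_dvd_of_eval_eq_zero [Infinite K] (G : MvPolynomial (Fin 2) K) {m : ℕ} (hG : G.IsHomogeneous m) (c : K)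
    (h : MvPolynomial.eval (![c, 1] : Fin 2 → K) G = 0) :
    (X 0 - C c * X 1 : MvPolynomial (Fin 2) K) ∣ G := by
  set P : Polynomial (MvPolynomial (Fin 1) K) := finSuccEquiv K 1 G with hP
  set a : MvPolynomial (Fin 1) K := C c * X 0 with ha
  have hroot : P.IsRoot a := by
    change Polynomial.eval a P = 0
    apply MvPolynomial.funext
    intro s
    rw [map_zero]
    have h1 : MvPolynomial.eval s (Polynomial.eval a P) =
        Polynomial.eval (MvPolynomial.eval s a) (P.map (MvPolynomial.eval s)) := by
      rw [Polynomial.eval_map, Polynomial.eval₂_hom]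
    rw [h1, hP, ← eval_eq_eval_mv_eval']
    have hcons : (Fin.cons (MvPolynomial.eval s a) s : Fin (1 + 1) → K) = s 0 • (![c, 1] : Fin 2 → K) := by
      funext j
      refine Fin.cases ?_ (fun i => ?_) j
      · simp only [Fin.cons_zero, ha, map_mul, eval_C, eval_X, Pi.smul_apply, Matrix.cons_val_zero, smul_eq_mul]
        ring
      · have hi : i = 0 := Subsingleton.elim _ _
        subst hi
        simp
    rw [hcons, eval_smul_of_isHomogeneous K hG, h, mul_zero]
  have hfac := (Polynomial.mul_divByMonic_eq_iff_isRoot (p := P) (a := a)).mpr hroot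
  -- back to `K[s, t]`
  have hsymm : (finSuccEquiv K 1).symm (Polynomial.X - Polynomial.C a) = X 0 - C c * X 1 := by
    have h0 : (finSuccEquiv K 1).symm Polynomial.X = (X 0 : MvPolynomial (Fin 2) K) := by
      rw [← finSuccEquiv_X_zero, AlgEquiv.symm_apply_apply]
    have h1 : (finSuccEquiv K 1).symm (Polynomial.C a) = (C c * X 1 : MvPolynomial (Fin 2) K) := by
      have h2 : finSuccEquiv K 1 (C c * X 1 : MvPolynomial (Fin 2) K) = Polynomial.C a := by
        have hC : finSuccEquiv K 1 (C c : MvPolynomial (Fin 2) K) = Polynomial.C (C c) := by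
          change finSuccEquiv K 1 (algebraMap K (MvPolynomial (Fin 2) K) c) = _
          rw [AlgEquiv.commutes, Polynomial.algebraMap_apply, MvPolynomial.algebraMap_eq]
        rw [map_mul, hC, ha, show (1 : Fin 2) = (0 : Fin 1).succ from rfl, finSuccEquiv_X_succ, ← map_mul]
      rw [← h2, AlgEquiv.symm_apply_apply]
    rw [map_sub, h0, h1]
  refine ⟨(finSuccEquiv K 1).symm (P /ₘ (Polynomial.X - Polynomial.C a)), ?_⟩
  have h3 := congrArg (finSuccEquiv K 1).symm hfac
  rw [map_mul, hsymm, hP, AlgEquiv.symm_apply_apply] at h3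
  exact h3.symm

/-- **A binary form vanishing at `[1 : 0]` is divisible by `t`** (swap the variables and take `c = 0`). [folklore] -/
theorem X_one_dvd_of_eval_eq_zero [Infinite K] (G : MvPolynomial (Fin 2) K) {m : ℕ} (hG : G.IsHomogeneous m)
    (h : MvPolynomial.eval (![1, 0] : Fin 2 → K) G = 0) : (X 1 : MvPolynomial (Fin 2) K) ∣ G := by
  set τ : Fin 2 ≃ Fin 2 := Equiv.swap 0 1 with hτ
  have hG' : (rename τ G).IsHomogeneous m := hG.rename_isHomogeneous
  have h' : MvPolynomial.eval (![0, 1] : Fin 2 → K) (rename τ G) = 0 := by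
    rw [eval_rename]
    have hfun : ((![0, 1] : Fin 2 → K) ∘ τ) = (![1, 0] : Fin 2 → K) := by
      funext j
      fin_cases j <;> simp [hτ]
    rw [hfun, h]
  have hd := X_sub_C_mul_X_dvd_of_eval_eq_zero K (rename τ G) hG' 0 h'
  rw [map_zero, zero_mul, sub_zero] at hd
  obtain ⟨Q, hQ⟩ := hd
  refine ⟨rename τ Q, ?_⟩
  have h2 := congrArg (rename τ) hQ
  have hττ : ∀ q : MvPolynomial (Fin 2) K, rename τ (rename τ q) = q := fun q => by
    rw [rename_rename]
    have : (τ ∘ τ : Fin 2 → Fin 2) = id := by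
      funext j
      simp [hτ, Equiv.swap_apply_self]
    rw [this, rename_id]
    rfl
  rw [hττ, map_mul, rename_X] at h2
  simpa [hτ] using h2

/-- **A common non-zero linear factor**: for `v ≠ 0` in `K²` there is a non-zero linear binary form dividing every form that vanishes at `v`.
[folklore] -/
theorem exists_linear_dvd [Infinite K] (v : Fin 2 → K) (hv : v ≠ 0) :
    ∃ ℓ : MvPolynomial (Fin 2) K, ℓ.IsHomogeneous 1 ∧ ℓ ≠ 0 ∧
      ∀ (G : MvPolynomial (Fin 2) K) (m : ℕ), G.IsHomogeneous m → MvPolynomial.eval v G = 0 → ℓ ∣ G := by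
  by_cases hv1 : v 1 = 0
  · have hv0 : v 0 ≠ 0 := by
      intro h0
      apply hv
      funext j
      fin_cases j
      · exact h0
      · exact hv1
    refine ⟨X 1, isHomogeneous_X K 1, X_ne_zero 1, fun G m hG hGv => X_one_dvd_of_eval_eq_zero K G hG ?_⟩
    have hv' : v = v 0 • (![1, 0] : Fin 2 → K) := by
      funext j
      fin_cases j
      · simp
      · simp [hv1]
    rw [hv', eval_smul_of_isHomogeneous K hG] at hGv
    exact (mul_eq_zero.mp hGv).resolve_left (pow_ne_zero _ hv0)
  · refine ⟨X 0 - C (v 0 / v 1) * X 1, (isHomogeneous_X K 0).sub (isHomogeneous_C_mul_X _ 1), ?_,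
      fun G m hG hGv => X_sub_C_mul_X_dvd_of_eval_eq_zero K G hG _ ?_⟩
    · intro h0
      have h := congrArg (MvPolynomial.eval (![1, 0] : Fin 2 → K)) h0
      simp at h
    · have hv' : v = v 1 • (![v 0 / v 1, 1] : Fin 2 → K) := by
        funext j
        fin_cases j
        · simp [mul_div_cancel₀ _ hv1]
        · simp
      rw [hv', eval_smul_of_isHomogeneous K hG] at hGv
      exact (mul_eq_zero.mp hGv).resolve_left (pow_ne_zero _ hv1)

/-- **A form of degree `≥ 2` with a non-zero linear factor is not prime** (the cofactor would be a unit, i.e. a constant, forcing degree `1`).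
[folklore] -/
theorem not_prime_of_linear_dvd {n : ℕ} (F ℓ : MvPolynomial (Fin n) K) {e : ℕ} (hF : F.IsHomogeneous e) (he : 2 ≤ e)
    (hℓ : ℓ.IsHomogeneous 1) (hℓ0 : ℓ ≠ 0) (hdvd : ℓ ∣ F) : ¬ Prime F := by
  intro hp
  obtain ⟨Q, hQ⟩ := hdvd
  rcases hp.irreducible.isUnit_or_isUnit hQ with hu | hu
  · have h1 := (MvPolynomial.isUnit_iff_totalDegree_of_isReduced.mp hu).2
    rw [hℓ.totalDegree hℓ0] at h1
    exact one_ne_zero h1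
  · obtain ⟨r, -, hr⟩ := MvPolynomial.isUnit_iff_eq_C_of_isReduced.mp hu
    rw [hr] at hQ
    have hF1 : F.IsHomogeneous 1 := by
      rw [hQ]
      simpa using hℓ.mul (isHomogeneous_C (σ := Fin n) r)
    have := hF.inj_right hF1 hp.ne_zero
    omega

/-! ## The side conditions from primality -/

section Family

variable {d : ℕ} (A B C : MvPolynomial (Fin 2) K) (hA : A.IsHomogeneous (d + 1)) (hB : B.IsHomogeneous (d + 1))
  (hC : C.IsHomogeneous (d + 2)) (F : MvPolynomial (Fin 4) K)
  (hF : F = X 0 * rename (![2, 3] : Fin 2 → Fin 4) A + X 1 * rename (![2, 3] : Fin 2 → Fin 4) B + rename (![2, 3] : Fin 2 → Fin 4) C)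

include hA hB hC hF in
/-- ★ **`F` prime ⟹ `A, B, C` have no common zero on `ℙ¹`** (`K` infinite): a common zero `v ≠ 0` yields a common non-zero linear factor
`ℓ(x₂, x₃)` of `A, B, C`, hence of `F`, of degree `d + 2 ≥ 2`. [folklore] -/
theorem no_common_zero_of_prime [Infinite K] (hprime : Prime F) :
    ∀ v : Fin 2 → K, v ≠ 0 → ¬ (MvPolynomial.eval v A = 0 ∧ MvPolynomial.eval v B = 0 ∧ MvPolynomial.eval v C = 0) := by
  rintro v hv ⟨ha, hb, hc⟩
  obtain ⟨ℓ, hℓ, hℓ0, hℓdvd⟩ := exists_linear_dvd K v hv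
  have hι : Function.Injective (![2, 3] : Fin 2 → Fin 4) := by decide
  refine not_prime_of_linear_dvd K F (rename (![2, 3] : Fin 2 → Fin 4) ℓ) (isHomogeneous_F K A B C hA hB hC F hF) (by omega)
    hℓ.rename_isHomogeneous (fun h0 => hℓ0 (rename_injective _ hι (by rw [h0, map_zero]))) ?_ hprime
  rw [hF]
  exact dvd_add (dvd_add (dvd_mul_of_dvd_right (map_dvd _ (hℓdvd A _ hA ha)) _)
    (dvd_mul_of_dvd_right (map_dvd _ (hℓdvd B _ hB hb)) _)) (map_dvd _ (hℓdvd C _ hC hc))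

/-- **Every binary form of positive degree over an algebraically closed field has a zero on `ℙ¹`**: either `G(t, 1)` has a root
(`IsAlgClosed.exists_root`), or it is a constant `κ` — then `κ = 0` gives `[0 : 1]`, and `κ ≠ 0` forces `G = κ·t^m`, vanishing at `[1 : 0]`.
[folklore] -/
theorem exists_eval_eq_zero [IsAlgClosed K] (G : MvPolynomial (Fin 2) K) {m : ℕ} (hG : G.IsHomogeneous m) (hm : 1 ≤ m) :
    ∃ v : Fin 2 → K, v ≠ 0 ∧ MvPolynomial.eval v G = 0 := by
  set q : Polynomial K := aeval (![Polynomial.X, 1] : Fin 2 → Polynomial K) G with hq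
  have hqev : ∀ t : K, Polynomial.eval t q = MvPolynomial.eval (![t, 1] : Fin 2 → K) G := by
    intro t
    rw [← Polynomial.coe_aeval_eq_eval, hq, comp_aeval_apply, ← MvPolynomial.aeval_eq_eval]
    have hfun : (fun i => Polynomial.aeval t ((![Polynomial.X, 1] : Fin 2 → Polynomial K) i)) = (![t, 1] : Fin 2 → K) := by
      funext j
      fin_cases j <;> simp
    rw [hfun]
  by_cases hq0 : q = 0
  · refine ⟨![0, 1], fun h => one_ne_zero (congrFun h 1), ?_⟩
    rw [← hqev, hq0, Polynomial.eval_zero]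
  by_cases hdeg : q.degree = 0
  · -- `q` is a non-zero constant `κ`: then `G = κ · t^m` vanishes at `[1 : 0]`
    set κ : K := q.coeff 0 with hκ
    have hqC : q = Polynomial.C κ := Polynomial.eq_C_of_degree_eq_zero hdeg
    have hGt : ∀ t : K, MvPolynomial.eval (![t, 1] : Fin 2 → K) G = κ := fun t => by
      rw [← hqev, hqC, Polynomial.eval_C]
    have hD : (G - C κ * X 1 ^ m).IsHomogeneous m := hG.sub (isHomogeneous_C_mul_X_pow κ 1 m)
    have hDX : ((G - C κ * X 1 ^ m) * X 1).IsHomogeneous (m + 1) := hD.mul (isHomogeneous_X K 1)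
    have hzero : (G - C κ * X 1 ^ m) * X 1 = 0 := by
      refine hDX.eq_zero_of_forall_eval_eq_zero fun r => ?_
      rw [map_mul, eval_X]
      by_cases hr : r 1 = 0
      · rw [hr, mul_zero]
      · have hr' : r = r 1 • (![r 0 / r 1, 1] : Fin 2 → K) := by
          funext j
          fin_cases j
          · simp [mul_div_cancel₀ _ hr]
          · simp
        have h1 : MvPolynomial.eval r (G - C κ * X 1 ^ m) = 0 := by
          rw [hr', eval_smul_of_isHomogeneous K hD, map_sub, hGt]
          simp
        rw [h1, zero_mul]
    have hG' : G = C κ * X 1 ^ m := sub_eq_zero.mp ((mul_eq_zero.mp hzero).resolve_right (X_ne_zero 1))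
    refine ⟨![1, 0], fun h => one_ne_zero (congrFun h 0), ?_⟩
    rw [hG']
    simp [zero_pow (by omega : m ≠ 0)]
  · obtain ⟨t, ht⟩ := IsAlgClosed.exists_root q hdeg
    exact ⟨![t, 1], fun h => one_ne_zero (congrFun h 1), by rw [← hqev]; exact ht⟩

include hA hB hC hF in
/-- ★ **`F` prime ⟹ `(A, B) ≠ (0, 0)`** (`K = K̄`): otherwise `F = C(x₂, x₃)` is a binary form of degree `d + 2 ≥ 1`, which has a zero `v` on `ℙ¹`
(`exists_eval_eq_zero`) — a common zero of `A = 0, B = 0, C`, excluded by `no_common_zero_of_prime`. [folklore] -/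
theorem ne_zero_or_ne_zero_of_prime [IsAlgClosed K] (hprime : Prime F) : A ≠ 0 ∨ B ≠ 0 := by
  by_contra h
  push Not at h
  obtain ⟨hA0, hB0⟩ := h
  obtain ⟨v, hv, hvC⟩ := exists_eval_eq_zero K C hC (by omega)
  exact no_common_zero_of_prime K A B C hA hB hC F hF hprime v hv ⟨by rw [hA0, map_zero], by rw [hB0, map_zero], hvC⟩

include hA hB hC hF in
/-- ★ **REGULAR BLOW-UPS ALONG THE LINE FOR EVERY PRIME `F = x₀·A + x₁·B + C(x₂,x₃)`** (`K = K̄`): every blow-up of `H = V₊(F)` along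
`𝓘⟨Σ⟩ · 𝒪_H`, `Σ = V(x₂, x₃)`, is regular. [OURS · lh7] [cite: StacksProject, Tag 0804] -/
theorem isRegular_blowups_of_prime [IsAlgClosed K] (hprime : Prime F) :
    ∀ (Z : Scheme.{0}) (ρ : Z ⟶ (hypersurface F).left),
      IsBlowup ρ ((vanishingIdeal (⟨_, WhitneyCubic.isClosed_doubleLine K⟩ :
        Closeds (Literature.AlgebraicGeometry.Motives.projectiveSpace 3 K).left)).comap (hypersurfaceι F).left) →
      Scheme.IsRegular Z :=
  isRegular_blowups K A B C hA hB hC F hF hprime (ne_zero_or_ne_zero_of_prime K A B C hA hB hC F hF hprime)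
    (no_common_zero_of_prime K A B C hA hB hC F hF hprime)

include hA hB hC hF in
/-- ★ **REGULAR BLOW-UP MODEL FOR EVERY PRIME `F = x₀·A + x₁·B + C(x₂,x₃)`** (`K = K̄`, all `p`) — the currency of crux `EquisingularLift`'s open
residual (stmt-…-15660): a non-zero ideal sheaf on `H = V₊(F)` all of whose blow-ups are regular. [OURS · lh7] -/
theorem blowupModel_of_prime [IsAlgClosed K] (hprime : Prime F) :
    ∃ 𝔞 : (hypersurface F).left.IdealSheafData, 𝔞 ≠ ⊥ ∧
      ∀ (Z : Scheme.{0}) (π : Z ⟶ (hypersurface F).left), IsBlowup π 𝔞 → Scheme.IsRegular Z :=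
  blowupModel_submaxLine K A B C hA hB hC F hF hprime (ne_zero_or_ne_zero_of_prime K A B C hA hB hC F hF hprime)
    (no_common_zero_of_prime K A B C hA hB hC F hF hprime)

include hA hB hC hF in
/-- ★ **THE B‴ NOSE PREDICATE FOR EVERY PRIME `F = x₀·A + x₁·B + C(x₂,x₃)`** (`K = K̄`, any characteristic). [OURS · lh7] -/
theorem reachNoseTowerBTriplePrime_of_prime [IsAlgClosed K] (hprime : Prime F) :
    ReachNoseTowerBTriplePrime K 3 (hypersurface F).left (hypersurfaceι F).left :=
  reachNoseTowerBTriplePrime_submaxLine K A B C hA hB hC F hF hprime (ne_zero_or_ne_zero_of_prime K A B C hA hB hC F hF hprime)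
    (no_common_zero_of_prime K A B C hA hB hC F hF hprime)

include hA hB hC hF in
/-- ★★ **EL♮ FOR EVERY INTEGRAL SURFACE OF DEGREE `d + 2` IN `ℙ³` WITH THE LINE `V(x₂, x₃)` OF MULTIPLICITY `≥ d + 1`** — i.e. for every PRIME
`F = x₀·A(x₂,x₃) + x₁·B(x₂,x₃) + C(x₂,x₃)` (`A, B` forms of degree `d + 1`, `C` a form of degree `d + 2`): `ELNatAt p K 3 V₊(F) ι`, `K`
algebraically closed of characteristic `p`, ANY `p`; witness ONE blow-up of `ℙ³_{𝕎(K)}` along the `𝕎(K)`-line `V(x₂, x₃)`.  For `d = 1`: every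
integral cubic surface singular along that line — the four classical ruled/conical types and all cones over singular integral plane cubics, with no
case analysis. [OURS · lh7] [cite: Hartshorne1977, I Ex. 5.12] -/
theorem elNatAt_of_prime (p : ℕ) (hp : p.Prime) [CharP K p] [IsAlgClosed K] (hprime : Prime F) :
    Theorems.EquisingularLift.ELNatAt p K 3 (hypersurface F).left (hypersurfaceι F).left :=
  elNatAt_submaxLine K A B C hA hB hC F hF hprime (ne_zero_or_ne_zero_of_prime K A B C hA hB hC F hF hprime)
    (no_common_zero_of_prime K A B C hA hB hC F hF hprime) p hp

end Family

end SubmaxLine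

end Summit.ResolutionOfSingularities.ResolutionOfSingularities.Cruxes.EquisingularLiftNat.Sections

end
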